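import Mathlib

/-!
# Hilbert's inequality (discrete form, constant `π`)

G. H. Hardy, J. E. Littlewood, G. Pólya, *Inequalities* (2nd ed., Cambridge 1952), Chapter IX,
Theorem 315 (Hilbert's double-series theorem, Schur's constant `π`):

> `Σ_{m,n ≥ 1} a_m b_n / (m + n) ≤ π (Σ a_m²)^{1/2} (Σ b_n²)^{1/2}`.

This file proves the quadratic-form case `a = b` for finitely supported real sequences,
`Σ_{i,j < N} x_i x_j / ((i+1) + (j+1)) ≤ π Σ_{i < N} x_i²` (`hilbert_inequality`), by Schur's test with
the weights `(i+1)^{-1/2}`: the row sums `Σ_{n ≥ 1} 1/((m+n)√n)` are bounded by `π/√m`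
(`sum_inv_mul_sqrt_le`, the integral test against the antiderivative `(2/√m)·arctan(√x/√m)` via the
mean value theorem), and `x_i x_j ≤ (x_i² w_i/w_j + x_j² w_j/w_i)/2` termwise.  No sign condition on
`x` is needed.  The constant `π` is sharp (not proved here).

-- TODO(general form): the bilinear statement with two sequences (it follows from this one by the Schwarz
-- inequality for the positive semi-definite Hilbert kernel `1/(m+n) = ∫₀¹ t^{m-1/2} t^{n-1/2} dt`), the
-- strict inequality for non-null sequences, and the infinite-series / `ℓ²` operator-norm formulations.
-/

namespace Literature.Analysis.OperatorTheory.HilbertInequality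

open Real Finset

/-- The antiderivative of the Schur row-sum integrand: for `m, x > 0`,
`d/dx [(2/√m)·arctan(√x/√m)] = 1/((m + x)√x)`. [folklore] -/
theorem hasDerivAt_arctan_sqrt_div {m x : ℝ} (hm : 0 < m) (hx : 0 < x) :
    HasDerivAt (fun y : ℝ => 2 / Real.sqrt m * Real.arctan (Real.sqrt y / Real.sqrt m))
      (1 / ((m + x) * Real.sqrt x)) x := by
  have hsm : 0 < Real.sqrt m := Real.sqrt_pos.2 hm
  have hsx : 0 < Real.sqrt x := Real.sqrt_pos.2 hx
  have h1 : HasDerivAt (fun y => Real.sqrt y / Real.sqrt m) (1 / (2 * Real.sqrt x) / Real.sqrt m) x :=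
    (Real.hasDerivAt_sqrt hx.ne').div_const _
  have h2 := h1.arctan
  have h3 := h2.const_mul (2 / Real.sqrt m)
  have heq : 2 / Real.sqrt m * (1 / (1 + (Real.sqrt x / Real.sqrt m) ^ 2) *
      (1 / (2 * Real.sqrt x) / Real.sqrt m)) = 1 / ((m + x) * Real.sqrt x) := by
    have hmx : (Real.sqrt x / Real.sqrt m) ^ 2 = x / m := by
      rw [div_pow, Real.sq_sqrt hx.le, Real.sq_sqrt hm.le]
    rw [hmx]
    have hsm0 : Real.sqrt m ≠ 0 := hsm.ne'
    have hsx0 : Real.sqrt x ≠ 0 := hsx.ne'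
    have hmx0 : m + x ≠ 0 := by positivity
    have hmm2 : Real.sqrt m ^ 2 = m := Real.sq_sqrt hm.le
    have hm0 : m ≠ 0 := hm.ne'
    field_simp
    linarith [hmm2]
  rw [heq] at h3
  exact h3

/-- One step of the integral test (mean value theorem + monotonicity of `x ↦ 1/((m+x)√x)`): for
`0 ≤ a`, `1/((m + a + 1)√(a+1)) ≤ F_m(a+1) − F_m(a)` with `F_m(x) = (2/√m)·arctan(√x/√m)`. [folklore] -/
theorem inv_mul_sqrt_le_arctan_step {m a : ℝ} (hm : 0 < m) (ha : 0 ≤ a) :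
    1 / ((m + (a + 1)) * Real.sqrt (a + 1)) ≤
      2 / Real.sqrt m * Real.arctan (Real.sqrt (a + 1) / Real.sqrt m) -
        2 / Real.sqrt m * Real.arctan (Real.sqrt a / Real.sqrt m) := by
  have hab : a < a + 1 := by linarith
  have hcont : Continuous (fun y : ℝ => 2 / Real.sqrt m * Real.arctan (Real.sqrt y / Real.sqrt m)) := by
    fun_prop
  obtain ⟨c, hc, hcd⟩ := exists_hasDerivAt_eq_slope
    (fun y : ℝ => 2 / Real.sqrt m * Real.arctan (Real.sqrt y / Real.sqrt m))
    (fun x => 1 / ((m + x) * Real.sqrt x)) hab hcont.continuousOn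
    (fun x hx => hasDerivAt_arctan_sqrt_div hm (lt_of_le_of_lt ha hx.1))
  have hc0 : 0 < c := lt_of_le_of_lt ha hc.1
  have hslope : 2 / Real.sqrt m * Real.arctan (Real.sqrt (a + 1) / Real.sqrt m) -
      2 / Real.sqrt m * Real.arctan (Real.sqrt a / Real.sqrt m) = 1 / ((m + c) * Real.sqrt c) := by
    have : (a + 1 - a) = (1 : ℝ) := by ring
    rw [this, div_one] at hcd
    exact hcd.symm
  rw [hslope]
  -- `f` is antitone on `(0, ∞)` and `c ≤ a + 1`
  have hc1 : c ≤ a + 1 := hc.2.le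
  have hpos : 0 < (m + c) * Real.sqrt c := by positivity
  apply one_div_le_one_div_of_le hpos
  have h1 : m + c ≤ m + (a + 1) := by linarith
  have h2 : Real.sqrt c ≤ Real.sqrt (a + 1) := Real.sqrt_le_sqrt hc1
  exact mul_le_mul h1 h2 (Real.sqrt_nonneg _) (by positivity)

/-- **Schur-test row sum.**  For real `m > 0` and every `N`: `Σ_{n=1}^{N} 1/((m+n)√n) ≤ π/√m`
(`= ∫₀^∞ dx/((m+x)√x)`). [cite: HardyLittlewoodPolya1952, Ch. IX §9.3, proof of Thm 315] -/
theorem sum_inv_mul_sqrt_le {m : ℝ} (hm : 0 < m) (N : ℕ) :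
    ∑ n ∈ range N, 1 / ((m + ((n : ℝ) + 1)) * Real.sqrt ((n : ℝ) + 1)) ≤ π / Real.sqrt m := by
  set F : ℝ → ℝ := fun y => 2 / Real.sqrt m * Real.arctan (Real.sqrt y / Real.sqrt m) with hF
  have hstep : ∀ n ∈ range N, 1 / ((m + ((n : ℝ) + 1)) * Real.sqrt ((n : ℝ) + 1)) ≤
      F ((n : ℝ) + 1) - F (n : ℝ) := fun n _ => inv_mul_sqrt_le_arctan_step hm (Nat.cast_nonneg n)
  refine (sum_le_sum hstep).trans ?_
  have hF0 : F 0 = 0 := by simp [hF]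
  have htel : ∑ n ∈ range N, (F ((n : ℝ) + 1) - F (n : ℝ)) = F (N : ℝ) := by
    have := Finset.sum_range_sub (fun n : ℕ => F (n : ℝ)) N
    simp only [Nat.cast_succ] at this
    rw [this, Nat.cast_zero, hF0, sub_zero]
  rw [htel, hF]
  have hsm : 0 < Real.sqrt m := Real.sqrt_pos.2 hm
  have hat : Real.arctan (Real.sqrt N / Real.sqrt m) ≤ π / 2 := (Real.arctan_lt_pi_div_two _).le
  calc 2 / Real.sqrt m * Real.arctan (Real.sqrt N / Real.sqrt m)
      ≤ 2 / Real.sqrt m * (π / 2) := mul_le_mul_of_nonneg_left hat (by positivity)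
    _ = π / Real.sqrt m := by field_simp

/-- **Hilbert's inequality** (discrete, quadratic-form case, constant `π`): for real `x_1, …, x_N`,
`Σ_{i,j ≤ N} x_i x_j / (i + j) ≤ π Σ_i x_i²` (indices from `1`, written `i+1`, `j+1` over `range N`).
Schur's test with weights `(i+1)^{-1/2}`; no sign condition on `x`.
[cite: HardyLittlewoodPolya1952, Ch. IX, Thm 315 (case a = b)] -/
theorem hilbert_inequality (N : ℕ) (x : ℕ → ℝ) :
    ∑ i ∈ range N, ∑ j ∈ range N, x i * x j / (((i : ℝ) + 1) + ((j : ℝ) + 1)) ≤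
      π * ∑ i ∈ range N, x i ^ 2 := by
  -- Schur test with weights `w_i = (i+1)^{-1/2}`
  set w : ℕ → ℝ := fun i => Real.sqrt ((i : ℝ) + 1) with hw
  have hwpos : ∀ i, 0 < w i := fun i => Real.sqrt_pos.2 (by positivity)
  -- termwise AM–GM: `x_i x_j ≤ (x_i² w_i/w_j + x_j² w_j/w_i)/2`
  have hamgm : ∀ i j, x i * x j ≤ (x i ^ 2 * (w i / w j) + x j ^ 2 * (w j / w i)) / 2 := by
    intro i j
    have hi := hwpos i; have hj := hwpos j
    have key : 0 ≤ (x i * Real.sqrt (w i / w j) - x j * Real.sqrt (w j / w i)) ^ 2 := sq_nonneg _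
    have e1 : Real.sqrt (w i / w j) ^ 2 = w i / w j := Real.sq_sqrt (by positivity)
    have e2 : Real.sqrt (w j / w i) ^ 2 = w j / w i := Real.sq_sqrt (by positivity)
    have e3 : Real.sqrt (w i / w j) * Real.sqrt (w j / w i) = 1 := by
      rw [← Real.sqrt_mul (by positivity)]
      have : w i / w j * (w j / w i) = 1 := by field_simp
      rw [this, Real.sqrt_one]
    have hexp : (x i * Real.sqrt (w i / w j) - x j * Real.sqrt (w j / w i)) ^ 2 =
        x i ^ 2 * (w i / w j) - 2 * (x i * x j) + x j ^ 2 * (w j / w i) := by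
      have : (x i * Real.sqrt (w i / w j) - x j * Real.sqrt (w j / w i)) ^ 2 =
          x i ^ 2 * Real.sqrt (w i / w j) ^ 2 -
            2 * (x i * x j) * (Real.sqrt (w i / w j) * Real.sqrt (w j / w i)) +
          x j ^ 2 * Real.sqrt (w j / w i) ^ 2 := by ring
      rw [this, e1, e2, e3, mul_one]
    rw [hexp] at key
    linarith
  have hK : ∀ i j : ℕ, 0 < ((i : ℝ) + 1) + ((j : ℝ) + 1) := fun i j => by positivity
  calc ∑ i ∈ range N, ∑ j ∈ range N, x i * x j / (((i : ℝ) + 1) + ((j : ℝ) + 1))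
      ≤ ∑ i ∈ range N, ∑ j ∈ range N,
          ((x i ^ 2 * (w i / w j)) / (((i : ℝ) + 1) + ((j : ℝ) + 1)) / 2 +
           (x j ^ 2 * (w j / w i)) / (((i : ℝ) + 1) + ((j : ℝ) + 1)) / 2) := by
        refine sum_le_sum fun i _ => sum_le_sum fun j _ => ?_
        have h := div_le_div_of_nonneg_right (hamgm i j) (hK i j).le
        have e : (x i ^ 2 * (w i / w j) + x j ^ 2 * (w j / w i)) / 2 / (((i : ℝ) + 1) + ((j : ℝ) + 1)) =
            (x i ^ 2 * (w i / w j)) / (((i : ℝ) + 1) + ((j : ℝ) + 1)) / 2 +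
            (x j ^ 2 * (w j / w i)) / (((i : ℝ) + 1) + ((j : ℝ) + 1)) / 2 := by ring
        rw [e] at h
        exact h
    _ = ∑ i ∈ range N, ∑ j ∈ range N, (x i ^ 2 * (w i / w j)) / (((i : ℝ) + 1) + ((j : ℝ) + 1)) := by
        have hsplit : ∑ i ∈ range N, ∑ j ∈ range N,
            ((x i ^ 2 * (w i / w j)) / (((i : ℝ) + 1) + ((j : ℝ) + 1)) / 2 +
             (x j ^ 2 * (w j / w i)) / (((i : ℝ) + 1) + ((j : ℝ) + 1)) / 2) =
            ∑ i ∈ range N, ∑ j ∈ range N, (x i ^ 2 * (w i / w j)) / (((i : ℝ) + 1) + ((j : ℝ) + 1)) / 2 +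
            ∑ i ∈ range N, ∑ j ∈ range N, (x j ^ 2 * (w j / w i)) / (((i : ℝ) + 1) + ((j : ℝ) + 1)) / 2 := by
          rw [← sum_add_distrib]
          exact sum_congr rfl fun i _ => sum_add_distrib
        have hswap : ∑ i ∈ range N, ∑ j ∈ range N,
            (x j ^ 2 * (w j / w i)) / (((i : ℝ) + 1) + ((j : ℝ) + 1)) / 2 =
            ∑ i ∈ range N, ∑ j ∈ range N,
            (x i ^ 2 * (w i / w j)) / (((i : ℝ) + 1) + ((j : ℝ) + 1)) / 2 := by
          rw [sum_comm]
          exact sum_congr rfl fun i _ => sum_congr rfl fun j _ => by ring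
        rw [hsplit, hswap, ← sum_add_distrib]
        refine sum_congr rfl fun i _ => ?_
        rw [← sum_add_distrib]
        exact sum_congr rfl fun j _ => by ring
    _ = ∑ i ∈ range N, x i ^ 2 * w i *
          ∑ j ∈ range N, 1 / ((((i : ℝ) + 1) + ((j : ℝ) + 1)) * w j) := by
        refine sum_congr rfl fun i _ => ?_
        rw [mul_sum]
        refine sum_congr rfl fun j _ => ?_
        have hj := (hwpos j).ne'
        have hk := (hK i j).ne'
        field_simp
    _ ≤ ∑ i ∈ range N, x i ^ 2 * w i * (π / w i) := by
        refine sum_le_sum fun i _ => ?_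
        refine mul_le_mul_of_nonneg_left ?_ (by have := hwpos i; positivity)
        have := sum_inv_mul_sqrt_le (m := (i : ℝ) + 1) (by positivity) N
        simpa [hw] using this
    _ = π * ∑ i ∈ range N, x i ^ 2 := by
        rw [mul_sum]
        refine sum_congr rfl fun i _ => ?_
        have hi := (hwpos i).ne'
        field_simp


end Literature.Analysis.OperatorTheory.HilbertInequality
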